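import Mathlib
import Literature.Probability.Percolation.Percolation

/-!
# `AdditiveGluing` (crux stmt-CriticalPhenomena-4576, route `PercNearOneGluing`):
# a certified in-tree checker of the inequality at density `1/2` — the checker and the
# correctness of its reachability computation (ccert seat, computational support file)

The crux `Summit.CriticalPhenomena.PercolationContinuityZ3.Theses.PercNearOneGluing.AdditiveGluing`
claims, for every finite weighted graph, `P(o ↔ A) − t ≤ P(o ↔ b)` whenever `0 ≤ t` and
`P(a ↔ b) ≥ 1 − t` for all `a ∈ A`.  It is "finitely refutable": one weighted graph refutes it.
Until now every check of it in this project was an off-tree computation.  This file and its two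
companions (`CertSoundness.lean`, `CertHalfLeFive.lean`) make the density-`1/2` blocks of that
search KERNEL-CHECKABLE:

* Part 1 (this file, computable): a bit-mask checker.  A configuration of a simple graph on the
  vertex set `Fin n` is a list of open vertex pairs; `adjMask` is its adjacency bit matrix,
  `reachM` the closure of `{o}` under "add all neighbours of marked vertices" iterated `n` times,
  `tables` the reach masks of all `2^m` sub-configurations of an edge list, `cntConn` /
  `cntConnSet` the exact counts `#{ω : o ↔ b}` and `#{ω : o ↔ A}` (every configuration has
  probability `2^{-m}` at density `1/2`, so probabilities are these integers over `2^m`),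
  `agGraph` the inequality in count form `∃ a ∈ A, #{o ↔ A} ≤ #{o ↔ b} + (2^m − #{a ↔ b})` for all
  `(o, b, A ≠ ∅)`, and `agAll n` its conjunction over ALL simple graphs on `Fin n` (all sub-lists
  of `allPairs n`).  `agAll n` is meant to be evaluated by `native_decide` (`CertHalfLeFive.lean`).
* Part 2 (this file, proofs): the reach mask IS reachability in the open graph
  `openGraph ↑(Eset ω)` of the configuration (`testBit_reachM_iff`: soundness by induction on the
  iteration, completeness because a reachable vertex is joined by a path of length `< n`,
  `SimpleGraph.Walk.IsPath.length_lt`), hence the per-configuration agreement of the two counting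
  predicates with the events `openConn o b` and `⋃ a ∈ A, openConn o a`
  (`testBit_reachTable_iff_mem_openConn`, `and_maskL_iff_mem_iUnion`).

Also here: `card_filter_powerset_Eset` — the sub-lists of an edge list enumerate the powerset of its
edge set exactly once, so the checker's counts are cardinalities of sets of sub-configurations.
The probability bridge (`prodBernoulli` at the weights `𝟙_E · 1/2` is `2^{-|E|}` × counting) and the
soundness theorem `agAll n = true → AG on every simple graph on Fin n at density 1/2` are in
`CertSoundness.lean`.  Nothing here asserts the crux; no proposition is defined under `Summits/`
(only computable functions and two abbreviations of data: `mkE`, `Eset`, `maskL`).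
-/

namespace Summit.CriticalPhenomena.PercolationContinuityZ3.Theorems.AdditiveGluing.Negative.Cert

/-! ## Part 1. The checker (computable; evaluated by `native_decide`) -/

section Checker

/-- Bit position of the ORDERED vertex pair `(i, j)` in an `n × n` bit matrix. -/
def slot (n i j : ℕ) : ℕ := j + i * n

/-- Adjacency bit matrix of a configuration given as a list of open vertex pairs
(both orientations are set). -/
def adjMask (n : ℕ) : List (Fin n × Fin n) → ℕ
  | [] => 0
  | p :: l => adjMask n l ||| 2 ^ slot n p.1 p.2 ||| 2 ^ slot n p.2 p.1

/-- Row `v` of the bit matrix `M`: for `u < n`, bit `u` of `row n M v` is bit `slot n v u` of `M`. -/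
def row (n M v : ℕ) : ℕ := (M >>> (v * n)) &&& (2 ^ n - 1)

/-- One closure step of the marked vertex set `R` (a bit mask): add the neighbours of every
marked vertex `v < n`. -/
def stepM (n M R : ℕ) : ℕ :=
  (List.range n).foldr (fun v acc => if R.testBit v then acc ||| row n M v else acc) R

/-- The set of vertices reachable from `o` (bit mask): `n` closure steps from `{o}`. -/
def reachM (n M o : ℕ) : ℕ := (stepM n M)^[n] (2 ^ o)

/-- The reach masks of all sources `o < n` of one configuration. -/
def reachTable (n : ℕ) (ω : List (Fin n × Fin n)) : List ℕ :=
  (List.range n).map (reachM n (adjMask n ω))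

/-- The reach tables of all `2^m` sub-configurations of the edge list `es` (`m = es.length`). -/
def tables (n : ℕ) (es : List (Fin n × Fin n)) : List (List ℕ) :=
  es.sublists'.map (reachTable n)

/-- `#{ω ⊆ E : o ↔ b in ω}`. -/
def cntConn (tabs : List (List ℕ)) (o b : ℕ) : ℕ :=
  tabs.countP fun tb => (tb.getD o 0).testBit b

/-- `#{ω ⊆ E : o ↔ A in ω}` for the vertex set `A` given as a bit mask `Am`. -/
def cntConnSet (tabs : List (List ℕ)) (o Am : ℕ) : ℕ :=
  tabs.countP fun tb => (tb.getD o 0) &&& Am != 0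

/-- The additive gluing inequality in COUNT form for every `(o, b, A)` of the graph with edge list
`es` on `n` vertices at density `1/2`:  for all `o b < n` and every non-empty `A` (mask `Am`),
`∃ a ∈ A, #{o ↔ A} ≤ #{o ↔ b} + (2^m − #{a ↔ b})`, i.e.
`P(o ↔ A) − max_{a ∈ A} P(a ↮ b) ≤ P(o ↔ b)`. -/
def agGraph (n : ℕ) (es : List (Fin n × Fin n)) : Bool :=
  let tabs := tables n es
  let N := tabs.length
  let cm := (List.range n).map fun o => (List.range n).map fun b => cntConn tabs o b
  let am := (List.range n).map fun o => (List.range (2 ^ n)).map fun Am => cntConnSet tabs o Am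
  (List.range n).all fun o => (List.range n).all fun b => (List.range (2 ^ n)).all fun Am =>
    Am == 0 || (List.range n).any fun a =>
      Am.testBit a &&
        decide ((am.getD o []).getD Am 0 ≤ (cm.getD o []).getD b 0 + (N - (cm.getD a []).getD b 0))

/-- All vertex pairs `(i, j)` with `i < j < n`. -/
def allPairs (n : ℕ) : List (Fin n × Fin n) :=
  ((List.finRange n) ×ˢ (List.finRange n)).filter fun p => p.1 < p.2

/-- THE CHECK: the additive gluing inequality at density `1/2` for every simple graph on the
vertex set `Fin n` (every sub-list of `allPairs n`) and every `(o, b, A)`. -/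
def agAll (n : ℕ) : Bool := (allPairs n).sublists'.all (agGraph n)

end Checker

/-! ## Part 2. Soundness -/

open MeasureTheory
open Literature.Probability.Percolation Literature.Probability.LatticeModels

/-! ### Bit lemmas -/

/-- `slot n` is injective on pairs with second entries `< n`. -/
theorem slot_inj {n a b c d : ℕ} (hb : b < n) (hd : d < n) (h : slot n a b = slot n c d) :
    a = c ∧ b = d := by
  have hn : 0 < n := lt_of_le_of_lt (Nat.zero_le b) hb
  have h1 : (b + a * n) / n = (d + c * n) / n := by unfold slot at h; rw [h]
  have h2 : (b + a * n) % n = (d + c * n) % n := by unfold slot at h; rw [h]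
  rw [Nat.add_mul_div_right _ _ hn, Nat.add_mul_div_right _ _ hn, Nat.div_eq_of_lt hb,
    Nat.div_eq_of_lt hd] at h1
  rw [Nat.add_mul_mod_self_right, Nat.add_mul_mod_self_right, Nat.mod_eq_of_lt hb,
    Nat.mod_eq_of_lt hd] at h2
  exact ⟨by simpa using h1, h2⟩

/-- Bit `slot n x y` of the adjacency matrix is set iff `(x, y)` or `(y, x)` is an open pair. -/
theorem testBit_adjMask {n : ℕ} (ω : List (Fin n × Fin n)) (x y : Fin n) :
    (adjMask n ω).testBit (slot n x y) = true ↔ ∃ p ∈ ω, p = (x, y) ∨ p = (y, x) := by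
  induction ω with
  | nil => simp [adjMask]
  | cons p l ih =>
    simp only [adjMask, Nat.testBit_or, Bool.or_eq_true, ih, Nat.testBit_two_pow,
      decide_eq_true_eq, List.mem_cons, exists_eq_or_imp]
    constructor
    · rintro ((h | h) | h)
      · exact Or.inr h
      · obtain ⟨h1, h2⟩ := slot_inj p.2.2 y.2 h
        exact Or.inl (Or.inl (Prod.ext (Fin.ext h1) (Fin.ext h2)))
      · obtain ⟨h1, h2⟩ := slot_inj p.1.2 y.2 h
        exact Or.inl (Or.inr (Prod.ext (Fin.ext h2) (Fin.ext h1)))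
    · rintro ((h | h) | h)
      · subst h; exact Or.inl (Or.inr rfl)
      · subst h; exact Or.inr rfl
      · exact Or.inl (Or.inl h)

/-- Bit `u < n` of row `v` is bit `slot n v u` of the matrix. -/
theorem testBit_row {n M v u : ℕ} (hu : u < n) : (row n M v).testBit u = M.testBit (slot n v u) := by
  simp [row, hu, slot, Nat.add_comm]

/-- Bits of the folded closure step over an arbitrary vertex list. -/
theorem testBit_foldr_step (n M R : ℕ) (l : List ℕ) (u : ℕ) :
    (l.foldr (fun v acc => if R.testBit v then acc ||| row n M v else acc) R).testBit u = true ↔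
      R.testBit u = true ∨ ∃ v ∈ l, R.testBit v = true ∧ (row n M v).testBit u = true := by
  induction l with
  | nil => simp
  | cons v l ih =>
    simp only [List.foldr_cons, List.mem_cons, exists_eq_or_imp]
    by_cases hv : R.testBit v = true
    · rw [if_pos hv, Nat.testBit_or, Bool.or_eq_true, ih]
      constructor
      · rintro ((h | h) | h)
        · exact Or.inl h
        · exact Or.inr (Or.inr h)
        · exact Or.inr (Or.inl ⟨hv, h⟩)
      · rintro (h | ⟨-, h⟩ | h)
        · exact Or.inl (Or.inl h)
        · exact Or.inr h
        · exact Or.inl (Or.inr h)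
    · rw [if_neg hv, ih]
      constructor
      · rintro (h | h)
        · exact Or.inl h
        · exact Or.inr (Or.inr h)
      · rintro (h | ⟨h, -⟩ | h)
        · exact Or.inl h
        · exact absurd h hv
        · exact Or.inr h

/-- Bits of one closure step: marked before, or a neighbour of a marked vertex `v < n`. -/
theorem testBit_stepM {n M R u : ℕ} :
    (stepM n M R).testBit u = true ↔
      R.testBit u = true ∨ ∃ v < n, R.testBit v = true ∧ (row n M v).testBit u = true := by
  unfold stepM
  rw [testBit_foldr_step]
  simp only [List.mem_range]

/-- A closure step only adds vertices. -/
theorem testBit_stepM_of_testBit {n M R u : ℕ} (h : R.testBit u = true) :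
    (stepM n M R).testBit u = true := testBit_stepM.2 (Or.inl h)

/-- Iterated closure steps only add vertices. -/
theorem testBit_iterate_stepM_of_testBit {n M R u : ℕ} (h : R.testBit u = true) (k : ℕ) :
    ((stepM n M)^[k] R).testBit u = true := by
  induction k with
  | zero => simpa using h
  | succ k ih => rw [Function.iterate_succ_apply']; exact testBit_stepM_of_testBit ih

/-! ### The open graph of a configuration list -/

/-- The unordered pair of an ordered pair. -/
def mkE {n : ℕ} (p : Fin n × Fin n) : Sym2 (Fin n) := s(p.1, p.2)

/-- `mkE p = s(x, y)` iff `p` is `(x, y)` or `(y, x)`. -/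
theorem mkE_eq_iff {n : ℕ} (p : Fin n × Fin n) (x y : Fin n) :
    mkE p = s(x, y) ↔ p = (x, y) ∨ p = (y, x) := by
  obtain ⟨a, b⟩ := p
  simp only [mkE, Sym2.eq_iff, Prod.mk.injEq]

/-- The edge set (unordered pairs) of a list of vertex pairs. -/
def Eset {n : ℕ} (l : List (Fin n × Fin n)) : Finset (Sym2 (Fin n)) := (l.map mkE).toFinset

/-- The empty list has no edges. -/
theorem Eset_nil {n : ℕ} : Eset ([] : List (Fin n × Fin n)) = ∅ := by simp [Eset]

/-- `Eset` of a cons. -/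
theorem Eset_cons {n : ℕ} (p : Fin n × Fin n) (l : List (Fin n × Fin n)) :
    Eset (p :: l) = insert (mkE p) (Eset l) := by
  simp [Eset]

/-- Membership in `Eset`. -/
theorem mem_Eset_iff {n : ℕ} (l : List (Fin n × Fin n)) (x y : Fin n) :
    s(x, y) ∈ Eset l ↔ ∃ p ∈ l, p = (x, y) ∨ p = (y, x) := by
  simp only [Eset, List.mem_toFinset, List.mem_map, mkE_eq_iff]

/-- Adjacency in the open graph of a configuration list, read off the adjacency bit matrix. -/
theorem openGraph_Eset_adj {n : ℕ} (ω : List (Fin n × Fin n)) (x y : Fin n) :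
    (openGraph (↑(Eset ω) : Set (Sym2 (Fin n)))).Adj x y ↔
      (adjMask n ω).testBit (slot n x y) = true ∧ x ≠ y := by
  rw [openGraph_adj, Finset.mem_coe, mem_Eset_iff, testBit_adjMask]

/-- Soundness of the reach mask: every marked vertex is reachable. -/
theorem reachable_of_testBit_iterate {n : ℕ} (ω : List (Fin n × Fin n)) (o : Fin n) (k : ℕ) :
    ∀ u : Fin n, ((stepM n (adjMask n ω))^[k] (2 ^ (o : ℕ))).testBit u = true →
      (openGraph (↑(Eset ω) : Set (Sym2 (Fin n)))).Reachable o u := by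
  induction k with
  | zero =>
    intro u hu
    simp only [Function.iterate_zero, id_eq, Nat.testBit_two_pow, decide_eq_true_eq] at hu
    have : o = u := Fin.ext hu
    subst this
    exact SimpleGraph.Reachable.refl _
  | succ k ih =>
    intro u hu
    rw [Function.iterate_succ_apply', testBit_stepM] at hu
    rcases hu with hu | ⟨v, hv, hRv, hrow⟩
    · exact ih u hu
    · have hov := ih ⟨v, hv⟩ hRv
      rw [testBit_row u.2] at hrow
      by_cases hvu : (⟨v, hv⟩ : Fin n) = u
      · rw [← hvu]; exact hov
      · exact hov.trans (SimpleGraph.Adj.reachable ((openGraph_Eset_adj ω ⟨v, hv⟩ u).2 ⟨hrow, hvu⟩))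

/-- Completeness of the reach mask: after `k` steps every vertex at walk distance `≤ k` is marked. -/
theorem testBit_iterate_of_walk {n : ℕ} (ω : List (Fin n × Fin n)) (o : Fin n) (k : ℕ) :
    ∀ (u : Fin n) (q : (openGraph (↑(Eset ω) : Set (Sym2 (Fin n)))).Walk o u), q.length ≤ k →
      ((stepM n (adjMask n ω))^[k] (2 ^ (o : ℕ))).testBit u = true := by
  induction k with
  | zero =>
    intro u q hq
    have h0 : q.length = 0 := Nat.le_zero.1 hq
    have := SimpleGraph.Walk.eq_of_length_eq_zero h0
    subst this
    simp
  | succ k ih =>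
    intro u q hq
    obtain ⟨r, hr⟩ : ∃ r : (openGraph (↑(Eset ω) : Set (Sym2 (Fin n)))).Walk u o,
        r.length = q.length := ⟨q.reverse, by simp⟩
    cases r with
    | nil => exact testBit_iterate_stepM_of_testBit (by simp) _
    | cons h r' =>
      rw [SimpleGraph.Walk.length_cons] at hr
      have hk : r'.reverse.length ≤ k := by
        rw [SimpleGraph.Walk.length_reverse]; omega
      have hv := ih _ r'.reverse hk
      rw [Function.iterate_succ_apply', testBit_stepM]
      refine Or.inr ⟨_, Fin.is_lt _, hv, ?_⟩
      rw [testBit_row u.2]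
      exact ((openGraph_Eset_adj ω _ u).1 h.symm).1

/-- The reach mask computes reachability in the open graph of the configuration. -/
theorem testBit_reachM_iff {n : ℕ} (ω : List (Fin n × Fin n)) (o u : Fin n) :
    (reachM n (adjMask n ω) o).testBit u = true ↔
      (openGraph (↑(Eset ω) : Set (Sym2 (Fin n)))).Reachable o u := by
  refine ⟨reachable_of_testBit_iterate ω o n u, fun h => ?_⟩
  obtain ⟨p⟩ := h
  refine testBit_iterate_of_walk ω o n u p.bypass ?_
  have := p.bypass_isPath.length_lt
  rw [Fintype.card_fin] at this
  exact this.le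

/-- Lookup in a table indexed by `List.range`. -/
theorem getD_map_range {β : Type*} (f : ℕ → β) (d : β) {i m : ℕ} (hi : i < m) :
    ((List.range m).map f).getD i d = f i := by
  rw [List.getD_eq_getElem?_getD, List.getElem?_map, List.getElem?_range hi]; rfl

/-- Entry `o < n` of the reach table is the reach mask of `o`. -/
theorem reachTable_getD {n : ℕ} (ω : List (Fin n × Fin n)) (o : Fin n) :
    (reachTable n ω).getD o 0 = reachM n (adjMask n ω) o := by unfold reachTable; exact getD_map_range _ _ o.2

/-- Per-configuration agreement, two-point event. -/
theorem testBit_reachTable_iff_mem_openConn {n : ℕ} (ω : List (Fin n × Fin n)) (o b : Fin n) :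
    ((reachTable n ω).getD o 0).testBit b = true ↔
      (↑(Eset ω) : Set (Sym2 (Fin n))) ∈ openConn o b := by
  simp only [reachTable_getD, testBit_reachM_iff, openConn, Set.mem_setOf_eq]

/-- Bit mask of a list of vertices. -/
def maskL {n : ℕ} (l : List (Fin n)) : ℕ := l.foldr (fun (a : Fin n) m => m ||| 2 ^ a.val) 0

/-- Bits of `maskL`. -/
theorem testBit_maskL {n : ℕ} (l : List (Fin n)) (i : ℕ) :
    (maskL l).testBit i = true ↔ ∃ a ∈ l, (a : ℕ) = i := by
  induction l with
  | nil => simp [maskL]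
  | cons a l ih =>
    simp only [maskL] at ih ⊢
    rw [List.foldr_cons, Nat.testBit_or, Bool.or_eq_true, ih, Nat.testBit_two_pow, decide_eq_true_eq]
    simp only [List.mem_cons, exists_eq_or_imp]
    exact or_comm

/-- `maskL l < 2^n`. -/
theorem maskL_lt {n : ℕ} (l : List (Fin n)) : maskL l < 2 ^ n := by
  induction l with
  | nil => simp [maskL]
  | cons a l ih =>
    simp only [maskL] at ih ⊢
    rw [List.foldr_cons]
    exact Nat.or_lt_two_pow ih (Nat.pow_lt_pow_right (by norm_num) a.2)

/-- Two masks meet iff they share a set bit. -/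
theorem and_ne_zero_iff (r m : ℕ) : r &&& m ≠ 0 ↔ ∃ i, r.testBit i = true ∧ m.testBit i = true := by
  constructor
  · intro h
    obtain ⟨i, hi⟩ := Nat.exists_testBit_of_ne_zero h
    rw [Nat.testBit_and, Bool.and_eq_true] at hi
    exact ⟨i, hi⟩
  · rintro ⟨i, hr, hm⟩ h0
    have := congrArg (fun x => Nat.testBit x i) h0
    simp [Nat.testBit_and, hr, hm] at this

/-- Per-configuration agreement, point-to-set event. -/
theorem and_maskL_iff_mem_iUnion {n : ℕ} (ω : List (Fin n × Fin n)) (o : Fin n) (A : Finset (Fin n)) :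
    (((reachTable n ω).getD o 0) &&& maskL A.toList != 0) = true ↔
      (↑(Eset ω) : Set (Sym2 (Fin n))) ∈ ⋃ a ∈ A, openConn o a := by
  rw [bne_iff_ne, and_ne_zero_iff, Set.mem_iUnion₂]
  constructor
  · rintro ⟨i, hr, hm⟩
    obtain ⟨a, ha, rfl⟩ := (testBit_maskL _ _).1 hm
    exact ⟨a, Finset.mem_toList.1 ha, (testBit_reachTable_iff_mem_openConn ω o a).1 hr⟩
  · rintro ⟨a, ha, h⟩
    exact ⟨a, (testBit_reachTable_iff_mem_openConn ω o a).2 h,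
      (testBit_maskL _ _).2 ⟨a, Finset.mem_toList.2 ha, rfl⟩⟩

/-! ### Counting over configurations = counting over the powerset -/

/-- Counting the sub-configurations of an edge list with a property of their edge SET: the
sub-lists (`List.sublists'`) of a list of pairs with distinct unordered images enumerate the
powerset of its edge set exactly once. -/
theorem card_filter_powerset_Eset {n : ℕ} :
    ∀ (es : List (Fin n × Fin n)), (es.map mkE).Nodup →
      ∀ (f : Finset (Sym2 (Fin n)) → Bool),
        ((Eset es).powerset.filter fun S => f S = true).card =
          es.sublists'.countP fun ω => f (Eset ω)
  | [], _, f => by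
    simp only [List.sublists'_nil]
    by_cases hf : f ∅ = true <;> simp [Eset_nil, hf, Finset.filter_singleton]
  | p :: es, hnd, f => by
    rw [List.map_cons, List.nodup_cons] at hnd
    have ha : mkE p ∉ Eset es := by simpa [Eset] using hnd.1
    have e1 : ((Eset es).powerset.filter fun S => f S = true).card =
        es.sublists'.countP fun ω => f (Eset ω) := card_filter_powerset_Eset es hnd.2 f
    have e2 : ((Eset es).powerset.filter fun S => f (insert (mkE p) S) = true).card =
        es.sublists'.countP fun ω => f (insert (mkE p) (Eset ω)) :=
      card_filter_powerset_Eset es hnd.2 fun S => f (insert (mkE p) S)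
    have hinj : Set.InjOn (fun S : Finset (Sym2 (Fin n)) => insert (mkE p) S)
        (↑((Eset es).powerset.filter fun S => f (insert (mkE p) S) = true) :
          Set (Finset (Sym2 (Fin n)))) := by
      intro S hS T hT hST
      simp only [Finset.coe_filter, Set.mem_setOf_eq, Finset.mem_powerset] at hS hT
      have hS' : mkE p ∉ S := fun h => ha (hS.1 h)
      have hT' : mkE p ∉ T := fun h => ha (hT.1 h)
      have hST' : insert (mkE p) S = insert (mkE p) T := hST
      rw [← Finset.erase_insert hS', hST', Finset.erase_insert hT']
    have hdisj : Disjoint ((Eset es).powerset.filter fun S => f S = true)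
        (((Eset es).powerset.image (insert (mkE p))).filter fun S => f S = true) := by
      rw [Finset.disjoint_left]
      intro S hS hS2
      rw [Finset.mem_filter, Finset.mem_powerset] at hS
      rw [Finset.mem_filter, Finset.mem_image] at hS2
      obtain ⟨⟨T, _, rfl⟩, _⟩ := hS2
      exact ha (hS.1 (Finset.mem_insert_self _ _))
    rw [Eset_cons, Finset.powerset_insert, Finset.filter_union, Finset.card_union_of_disjoint hdisj,
      List.sublists'_cons, List.countP_append, List.countP_map, e1]
    simp only [Finset.filter_image]
    rw [Finset.card_image_of_injOn hinj, e2]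
    congr 1
    exact List.countP_congr fun ω _ => by simp [Eset_cons]

end Summit.CriticalPhenomena.PercolationContinuityZ3.Theorems.AdditiveGluing.Negative.Cert
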